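import Literature.Analysis.FluidPDE.PeriodicCylinderNeumannBandSmooth
import Literature.Analysis.FluidPDE.WeylLemmaPoissonBall
import HarnessLib

/-!
# Interior smoothness of the weak Neumann potential on the periodic cylinder

Topic `Literature/Analysis/FluidPDE`. Theorem-only file (no definitions, no named facts) of the
regularity theory for the weak periodic Neumann problem on the cylinder `{r ≤ 1} × ℝ/Lℤ`
(`PeriodicCylinderHelmholtz` … `PeriodicCylinderNeumannBandSmooth`; the analytic input of the local
existence theorem for the Euler equations in the periodic cylinder, T. Kato, C. Y. Lai,
J. Funct. Anal. **56** (1984), Thm I/II, named fact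
`Literature.Analysis.FluidPDE.KatoLai1984_periodicCylinderUniformExistence`; interior regularity of
the Neumann problem as in Kato–Lai §4 (i) and [14, Thm 5.5.2], here by Weyl's lemma).

Let `∇q = ∇q[h₀,h₁]` be the weak Neumann solution for smooth `L`-periodic data (`∫_cell h₀ = 0`)
and `q` its potential on the cell. Away from the wall `q` is a distributional solution of the
Poisson equation `Δq = div h₁ − h₀`:

* `exists_cylindrical_cutoff` — smooth radial cut-offs `θ(r)` (`1` for `r ≤ a`, `0` for `r ≥ b`;
  the tree's `radialCutoff` of the horizontal projection), periodic for every period;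
* `setIntegral_potential_mul_laplacian_ball` — **the weak Poisson equation on interior balls**:
  for a ball `B ⊆ cell` with `r < 0.8` on `B` and every `φ ∈ C_c^∞(B)`,
  `∫_B q Δφ = ∫_B (div h₁ − h₀) φ` (the weak Laplacian of the cut-off potential,
  `setIntegral_cutoff_potential_mul_laplacian`, with a cut-off `θ ≡ 1` on `{r ≤ 0.8}` and the
  periodisation of `φ` as the periodic test function: all cut-off terms drop out on `supp φ`);
* `exists_local_smooth_rep_interior` — **local smooth representatives in the interior**: around
  every point with `r < 0.7` (any height `z`, seams included) the periodic extension
  `Q = q ∘ axialRed` agrees a.e. on a ball with a globally smooth function whose gradient is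
  `∇q ∘ axialRed` a.e. (move the ball to mid-height by a shift of the data,
  `potential_shiftedData_ae_eq`; there Weyl's lemma for the Poisson equation on a ball,
  `WeylLemmaBall.exists_contDiff_rep_of_weakPoisson_ball`, with the smooth right-hand side
  `θ(div h₁ − h₀)` gives the representative, and `coe_neumannGrad_ae_eq_gradient` its gradient);
* `exists_tube_smooth_rep` — **a smooth `L`-periodic representative on the open tube
  `{r < 0.7} × ℝ`** with `Q = qI` and `∇q ∘ axialRed = ∇qI` a.e. there (patching,
  `exists_periodic_smooth_rep_of_local`).

Mathlib/tree search: tree `WeylLemmaBall` (Weyl's lemma on balls, harmonic case) and the new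
`WeylLemmaPoissonBall`; `radialCutoff` (`NewtonKernel`), `contDiff_horizontalProj`,
`horizontalProj_add_axialShift`, `norm_horizontalProj`; `periodize`/`contDiff_periodize`/
`periodize_eq_self` (`PeriodicCylinderSymmetry`); Mathlib `laplacian_congr_nhds`,
`InnerProductSpace.laplacian_const`, `setIntegral_eq_of_subset_of_forall_sdiff_eq_zero`.

## References

* T. Kato, C. Y. Lai, J. Funct. Anal. 56 (1984) 15–28, §4 (i). [KatoLai1984]
* H. Weyl, Duke Math. J. 7 (1940), 411–444, Lemma 2.
* L. C. Evans, *Partial Differential Equations*, 2nd ed. (2010), §6.3.1. [Evans2010]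
-/

noncomputable section

open MeasureTheory Set Function Filter Topology TopologicalSpace WithLp Metric Module
open scoped ContDiff NNReal ENNReal InnerProductSpace RealInnerProductSpace Laplacian

namespace Literature.Analysis.FluidPDE

open Literature.Analysis.FunctionSpaces

/-- Local notation for physical space `ℝ³ = EuclideanSpace ℝ (Fin 3)`. -/
local notation "ℝ³" => EuclideanSpace ℝ (Fin 3)

/-- Local notation for the closed unit cylinder `{r ≤ 1}`. -/
local notation "𝕂" => closure (SetLike.coe unitCylinder : Set (EuclideanSpace ℝ (Fin 3)))

namespace PeriodicCylinder

variable {L : ℝ}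

/-! ### Cylindrical cut-offs -/

/-- **Smooth cylindrical cut-offs**: for `0 ≤ a < b` there is a smooth function of the horizontal
projection (hence `L`-periodic for every `L`) equal to `1` for `r ≤ a` and to `0` for `r ≥ b`.
[folklore] -/
theorem exists_cylindrical_cutoff {a b : ℝ} (ha : 0 ≤ a) (hab : a < b) :
    ∃ θ : ℝ³ → ℝ, ContDiff ℝ ∞ θ ∧ (∀ L : ℝ, IsAxiallyPeriodic L θ) ∧
      (∀ x : ℝ³, cylRadius x ≤ a → θ x = 1) ∧ (∀ x : ℝ³, b ≤ cylRadius x → θ x = 0) := by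
  refine ⟨fun x => radialCutoff a b (horizontalProj x), ?_, ?_, ?_, ?_⟩
  · exact (radialCutoff_contDiff a b).comp contDiff_horizontalProj
  · intro L x
    show radialCutoff a b (horizontalProj (x + L • EuclideanSpace.single 2 1)) = radialCutoff a b (horizontalProj x)
    rw [horizontalProj_add_axialShift]
  · intro x hx
    exact radialCutoff_eq_one ha hab (by rwa [norm_horizontalProj])
  · intro x hx
    exact radialCutoff_eq_zero ha hab (by rwa [norm_horizontalProj])

/-- A smooth cut-off times a function smooth on an open set containing the support of the cut-off
is globally smooth. [folklore] -/
theorem contDiff_mul_of_contDiffOn_of_tsupport_subset {θ D : ℝ³ → ℝ} {U : Set ℝ³} (hU : IsOpen U)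
    (hθ : ContDiff ℝ ∞ θ) (hsupp : tsupport θ ⊆ U) (hD : ContDiffOn ℝ ∞ D U) :
    ContDiff ℝ ∞ fun x => θ x * D x := by
  refine contDiff_iff_contDiffAt.2 fun x => ?_
  by_cases hx : x ∈ U
  · exact hθ.contDiffAt.mul (hD.contDiffAt (hU.mem_nhds hx))
  · have hx' : x ∉ tsupport θ := fun h => hx (hsupp h)
    have hev : (fun y => θ y * D y) =ᶠ[𝓝 x] fun _ => 0 := by
      filter_upwards [notMem_tsupport_iff_eventuallyEq.1 hx'] with y hy
      simp only [hy, Pi.zero_apply, zero_mul]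
    exact (contDiffAt_const (c := (0 : ℝ))).congr_of_eventuallyEq hev

/-- `div h₁ − h₀` is smooth on the open cylinder for smooth periodic data. [folklore] -/
theorem contDiffOn_divergence_sub {h₀ : ℝ³ → ℝ} {h₁ : ℝ³ → ℝ³} (hh₀ : IsSmoothPeriodic L h₀)
    (hh₁ : IsSmoothPeriodic L h₁) :
    ContDiffOn ℝ ∞ (fun x => VectorCalculus.divergence h₁ x - h₀ x) (unitCylinder : Set ℝ³) := by
  refine ContDiffOn.sub ?_ (hh₀.smooth.mono subset_closure)
  exact ((contDiffOn_cylDiv hh₁.smooth).mono subset_closure).congr fun x hx => (cylDiv_eq_divergence h₁ hx).symm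

/-! ### The weak Poisson equation on interior balls -/

/-- **The potential solves `Δq = div h₁ − h₀` weakly on interior balls**: for the weak Neumann
solution `∇q[h₀,h₁]` with smooth periodic data (`∫_cell h₀ = 0`), its potential `q`, a ball
`B ⊆ cell` on which `r < 0.8`, and every `φ ∈ C_c^∞(B)`: `∫_B q Δφ = ∫_B (div h₁ − h₀) φ`.
[folklore] -/
theorem setIntegral_potential_mul_laplacian_ball (hL : 0 < L) {h₀ : ℝ³ → ℝ} {h₁ : ℝ³ → ℝ³}
    (hh₀ : IsSmoothPeriodic L h₀) (hh₁ : IsSmoothPeriodic L h₁)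
    (hmean : ∫ x in (cylinderCell L : Set ℝ³), h₀ x = 0) {c : ℝ³} {R : ℝ}
    (hBcell : ball c R ⊆ (cylinderCell L : Set ℝ³)) (hBr : ∀ x ∈ ball c R, cylRadius x < 0.8)
    {φ : ℝ³ → ℝ} (hφ : IsTestFunctionOn (⟨ball c R, isOpen_ball⟩ : Opens ℝ³) φ) :
    ∫ x in ball c R, ((potential (neumannGrad L (toCell L h₀) (toCell L h₁)) :
        Lp ℝ 2 (cellMeasure L)) : ℝ³ → ℝ) x * (Δ φ) x =
      ∫ x in ball c R, (VectorCalculus.divergence h₁ x - h₀ x) * φ x := by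
  set Gg : gradSpace L := neumannGrad L (toCell L h₀) (toCell L h₁) with hGg
  set q : ℝ³ → ℝ := ((potential Gg : Lp ℝ 2 (cellMeasure L)) : ℝ³ → ℝ) with hq
  set G : ℝ³ → ℝ³ := (((Gg : gradSpace L) : Lp ℝ³ 2 (cellMeasure L)) : ℝ³ → ℝ³) with hGdef
  obtain ⟨θ, hθs, hθp, hθ1, hθ0⟩ := exists_cylindrical_cutoff (a := 0.8) (b := 0.9) (by norm_num) (by norm_num)
  have hφ' : IsTestFunctionOn (cylinderCell L) φ :=
    hφ.mono (show (⟨ball c R, isOpen_ball⟩ : Opens ℝ³) ≤ cylinderCell L from fun x hx => hBcell hx)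
  have hΦs : ContDiff ℝ ∞ (periodize L φ) := contDiff_periodize hL hφ'
  have hΦp : IsAxiallyPeriodic L (periodize L φ) := isAxiallyPeriodic_periodize hL φ
  have key := setIntegral_cutoff_potential_mul_laplacian hL hh₀ hh₁ hmean hθs (hθp L) (δ := 0.1)
    (by norm_num) (fun x hx => hθ0 x (by linarith)) hΦs hΦp
  -- the cut-off near a point with `r < 0.8`
  have hθnhds : ∀ x : ℝ³, cylRadius x < 0.8 → θ =ᶠ[𝓝 x] fun _ => (1 : ℝ) := fun x hx => by
    filter_upwards [(isOpen_lt continuous_cylRadius continuous_const).mem_nhds hx] with y hy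
    exact hθ1 y hy.le
  have hθfd : ∀ x : ℝ³, cylRadius x < 0.8 → fderiv ℝ θ x = 0 := fun x hx => by
    rw [(hθnhds x hx).fderiv_eq]
    exact fderiv_const_apply _
  have hθΔ : ∀ x : ℝ³, cylRadius x < 0.8 → (Δ θ) x = 0 := fun x hx => by
    rw [(InnerProductSpace.laplacian_congr_nhds (hθnhds x hx)).eq_of_nhds, InnerProductSpace.laplacian_const, Pi.zero_apply]
  -- the periodisation agrees with `φ` on the cell, together with its Laplacian
  have hΦφ : ∀ x ∈ (cylinderCell L : Set ℝ³), periodize L φ x = φ x := fun x hx => periodize_eq_self hL φ hx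
  have hΔΦ : ∀ x ∈ (cylinderCell L : Set ℝ³), (Δ (periodize L φ)) x = (Δ φ) x := fun x hx => by
    have hev : periodize L φ =ᶠ[𝓝 x] φ := by
      filter_upwards [(cylinderCell L).isOpen.mem_nhds hx] with y hy
      exact hΦφ y hy
    exact (InnerProductSpace.laplacian_congr_nhds hev).eq_of_nhds
  -- supports
  have hsuppφ : ∀ x, φ x ≠ 0 → x ∈ ball c R := fun x hx =>
    hφ.tsupport_subset (subset_tsupport _ (mem_support.2 hx))
  have hsuppΔ : ∀ x, (Δ φ) x ≠ 0 → x ∈ ball c R := fun x hx => by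
    by_contra h
    exact hx (laplacian_eq_zero_of_notMem_tsupport fun h' => h (hφ.tsupport_subset h'))
  -- both sides of `key` on the cell
  have lhs : ∫ x in (cylinderCell L : Set ℝ³), θ x * q x * (Δ (periodize L φ)) x =
      ∫ x in (cylinderCell L : Set ℝ³), q x * (Δ φ) x := by
    refine setIntegral_congr_fun (cylinderCell L).isOpen.measurableSet fun x hx => ?_
    rw [hΔΦ x hx]
    by_cases hz : (Δ φ) x = 0
    · rw [hz, mul_zero, mul_zero]
    · rw [hθ1 x (hBr x (hsuppΔ x hz)).le, one_mul]
  have rhs : ∫ x in (cylinderCell L : Set ℝ³),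
      (θ x * (VectorCalculus.divergence h₁ x - h₀ x) + 2 * fderiv ℝ θ x (G x) + q x * (Δ θ) x) * periodize L φ x =
      ∫ x in (cylinderCell L : Set ℝ³), (VectorCalculus.divergence h₁ x - h₀ x) * φ x := by
    refine setIntegral_congr_fun (cylinderCell L).isOpen.measurableSet fun x hx => ?_
    rw [hΦφ x hx]
    by_cases hz : φ x = 0
    · rw [hz, mul_zero, mul_zero]
    · have hr := hBr x (hsuppφ x hz)
      rw [hθ1 x hr.le, hθfd x hr, hθΔ x hr]
      simp
  have e1 : ∫ x in (cylinderCell L : Set ℝ³), q x * (Δ φ) x = ∫ x in ball c R, q x * (Δ φ) x :=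
    setIntegral_eq_of_subset_of_forall_sdiff_eq_zero (cylinderCell L).isOpen.measurableSet hBcell fun x hx => by
      have : (Δ φ) x = 0 := by by_contra h; exact hx.2 (hsuppΔ x h)
      rw [this, mul_zero]
  have e2 : ∫ x in (cylinderCell L : Set ℝ³), (VectorCalculus.divergence h₁ x - h₀ x) * φ x =
      ∫ x in ball c R, (VectorCalculus.divergence h₁ x - h₀ x) * φ x :=
    setIntegral_eq_of_subset_of_forall_sdiff_eq_zero (cylinderCell L).isOpen.measurableSet hBcell fun x hx => by
      have : φ x = 0 := by by_contra h; exact hx.2 (hsuppφ x h)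
      rw [this, mul_zero]
  rw [lhs, rhs, e1, e2] at key
  exact key

/-! ### Local smooth representatives in the interior -/

/-- **Local smooth representatives in the interior**: around every point with `r < 0.7` — at any
height, seams included — the periodic extension `Q = q ∘ axialRed` of the potential of `∇q[h₀,h₁]`
agrees a.e. on a ball with a globally smooth function, whose gradient is `∇q ∘ axialRed` a.e. The
ball is first moved to mid-height of the cell by the shift `a = z₀ − L/2` of the data (covariance
`potential_shiftedData_ae_eq`); there the weak Poisson equation on a ball inside the cell and
Weyl's lemma (`WeylLemmaBall.exists_contDiff_rep_of_weakPoisson_ball`) give the representative.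
[folklore] -/
theorem exists_local_smooth_rep_interior (hL : 0 < L) {h₀ : ℝ³ → ℝ} {h₁ : ℝ³ → ℝ³}
    (hh₀ : IsSmoothPeriodic L h₀) (hh₁ : IsSmoothPeriodic L h₁)
    (hmean : ∫ x in (cylinderCell L : Set ℝ³), h₀ x = 0) {x₀ : ℝ³} (hr : cylRadius x₀ < 0.7) :
    ∃ ρ₀ : ℝ, 0 < ρ₀ ∧ ∃ g : ℝ³ → ℝ, ContDiffOn ℝ ∞ g (ball x₀ (2 * ρ₀)) ∧
      (∀ᵐ x ∂(volume.restrict (ball x₀ (2 * ρ₀))),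
        ((potential (neumannGrad L (toCell L h₀) (toCell L h₁)) : Lp ℝ 2 (cellMeasure L)) : ℝ³ → ℝ) (axialRed L x) = g x) ∧
      (∀ᵐ x ∂(volume.restrict (ball x₀ (2 * ρ₀))),
        ((((neumannGrad L (toCell L h₀) (toCell L h₁) : gradSpace L) : Lp ℝ³ 2 (cellMeasure L)) : ℝ³ → ℝ³))
          (axialRed L x) = gradient g x) := by
  -- the shift and the shifted data
  set a : ℝ := x₀ 2 - L / 2 with ha
  set k₀ : ℝ³ → ℝ := fun x => h₀ (x + a • eZ) with hk₀
  set k₁ : ℝ³ → ℝ³ := fun x => h₁ (x + a • eZ) with hk₁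
  have hk₀s : IsSmoothPeriodic L k₀ := hh₀.comp_add_smul_eZ a
  have hk₁s : IsSmoothPeriodic L k₁ := hh₁.comp_add_smul_eZ a
  have hkmean : ∫ x in (cylinderCell L : Set ℝ³), k₀ x = 0 := by
    simp only [hk₀]
    rw [integral_comp_add_smul_eZ hL a hh₀.periodic hh₀.memLp.1, hmean]
  -- the balls at mid-height
  set ρ₀ : ℝ := min (1 / 40) (L / 8) with hρ₀
  have hρ₀pos : 0 < ρ₀ := lt_min (by norm_num) (by positivity)
  have hρ₀1 : ρ₀ ≤ 1 / 40 := min_le_left _ _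
  have hρ₀2 : ρ₀ ≤ L / 8 := min_le_right _ _
  set c : ℝ³ := x₀ - a • eZ with hc
  have hc2 : c 2 = L / 2 := by simp [hc, ha]
  have hcr : cylRadius c = cylRadius x₀ := by
    rw [hc, sub_eq_add_neg, ← neg_smul, cylRadius_add_smul_eZ]
  have hcoord : ∀ (x y : ℝ³), |y 2 - x 2| ≤ dist y x := fun x y => by
    rw [dist_eq_norm, ← Real.norm_eq_abs]
    have h := PiLp.norm_apply_le (y - x) 2
    simpa using h
  have hball_r : ∀ y ∈ ball c (4 * ρ₀), cylRadius y < 0.8 := fun y hy => by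
    rw [mem_ball] at hy
    have hr' := abs_cylRadius_sub_le y c
    rw [← dist_eq_norm] at hr'
    have hr'' := abs_lt.1 (lt_of_le_of_lt hr' hy)
    nlinarith [hr''.2, hcr]
  have hball_cell : ball c (4 * ρ₀) ⊆ (cylinderCell L : Set ℝ³) := fun y hy => by
    have hry := hball_r y hy
    rw [mem_ball] at hy
    have hz := hcoord c y
    have hz' := abs_lt.1 (lt_of_le_of_lt hz hy)
    refine ⟨?_, ?_, ?_⟩
    · show cylRadius y < 1
      linarith
    · nlinarith [hz'.1, hc2]
    · nlinarith [hz'.2, hc2]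
  -- the smooth global right-hand side `θ (div k₁ − k₀)`
  obtain ⟨θ, hθs, -, hθ1, hθ0⟩ := exists_cylindrical_cutoff (a := 0.85) (b := 0.9) (by norm_num) (by norm_num)
  set D : ℝ³ → ℝ := fun x => VectorCalculus.divergence k₁ x - k₀ x with hD
  have hDs : ContDiffOn ℝ ∞ D (unitCylinder : Set ℝ³) := contDiffOn_divergence_sub hk₀s hk₁s
  have hθsupp : tsupport θ ⊆ (unitCylinder : Set ℝ³) := by
    have h1 : support θ ⊆ {x : ℝ³ | cylRadius x ≤ 0.9} := fun x hx => by
      by_contra h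
      exact hx (hθ0 x (not_le.1 h).le)
    refine (closure_minimal h1 (isClosed_le continuous_cylRadius continuous_const)).trans fun x hx => ?_
    rw [SetLike.mem_coe, mem_unitCylinder]
    exact lt_of_le_of_lt hx (by norm_num)
  set f : ℝ³ → ℝ := fun x => θ x * D x with hf
  have hfs : ContDiff ℝ ∞ f := contDiff_mul_of_contDiffOn_of_tsupport_subset unitCylinder.isOpen hθs hθsupp hDs
  -- the weak Poisson equation on the big ball for the shifted potential
  set q' : ℝ³ → ℝ := ((potential (neumannGrad L (toCell L k₀) (toCell L k₁)) : Lp ℝ 2 (cellMeasure L)) : ℝ³ → ℝ)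
    with hq'
  have hq'i : IntegrableOn q' (ball c (4 * ρ₀)) volume := by
    have h : IntegrableOn q' (cylinderCell L : Set ℝ³) volume := (Lp.memLp _).integrable one_le_two
    exact h.mono_set hball_cell
  have hweak : ∀ φ : ℝ³ → ℝ, IsTestFunctionOn (⟨ball c (4 * ρ₀), isOpen_ball⟩ : Opens ℝ³) φ →
      ∫ x in ball c (4 * ρ₀), q' x * (Δ φ) x = ∫ x in ball c (4 * ρ₀), f x * φ x := fun φ hφ => by
    rw [hq', setIntegral_potential_mul_laplacian_ball hL hk₀s hk₁s hkmean hball_cell hball_r hφ]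
    refine setIntegral_congr_fun measurableSet_ball fun x hx => ?_
    show (VectorCalculus.divergence k₁ x - k₀ x) * φ x = θ x * (VectorCalculus.divergence k₁ x - k₀ x) * φ x
    rw [hθ1 x (by linarith [hball_r x hx]), one_mul]
  obtain ⟨g, hgs, hqg⟩ := WeylLemmaBall.exists_contDiff_rep_of_weakPoisson_ball (r₁ := 2 * ρ₀) (by positivity)
    hq'i hfs hweak
  rw [show 4 * ρ₀ - 2 * ρ₀ = 2 * ρ₀ by ring] at hqg
  have hball2_cell : ball c (2 * ρ₀) ⊆ (cylinderCell L : Set ℝ³) :=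
    (ball_subset_ball (by linarith)).trans hball_cell
  set B : Opens ℝ³ := ⟨ball c (2 * ρ₀), isOpen_ball⟩ with hB
  have hGf := coe_neumannGrad_ae_eq_gradient hL (Ω' := B) (fun x hx => hball2_cell hx) hgs.contDiffOn hqg
  obtain ⟨hcovq, hcovG⟩ := potential_shiftedData_ae_eq hL a hh₀ hh₁
  -- on the ball: `g y = q (axialRed (y + a e_z))`, `∇g y = G (axialRed (y + a e_z))`
  have hBm : MeasurableSet (ball c (2 * ρ₀)) := isOpen_ball.measurableSet
  have hq_ball : ∀ᵐ y ∂(volume.restrict (ball c (2 * ρ₀))),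
      ((potential (neumannGrad L (toCell L h₀) (toCell L h₁)) : Lp ℝ 2 (cellMeasure L)) : ℝ³ → ℝ) (axialRed L (y + a • eZ)) = g y := by
    have h1 : ∀ᵐ y ∂(volume.restrict (ball c (2 * ρ₀))), _ := ae_restrict_of_ae_restrict_of_subset hball2_cell hcovq
    have h2 : ∀ᵐ y ∂(volume.restrict (ball c (2 * ρ₀))), q' y = g y := hqg
    filter_upwards [h1, h2] with y hy1 hy2
    rw [← hy2, hq', hy1, cellShift_apply]
  have hG_ball : ∀ᵐ y ∂(volume.restrict (ball c (2 * ρ₀))),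
      ((((neumannGrad L (toCell L h₀) (toCell L h₁) : gradSpace L) : Lp ℝ³ 2 (cellMeasure L)) : ℝ³ → ℝ³)) (axialRed L (y + a • eZ)) =
        gradient g y := by
    have h1 : ∀ᵐ y ∂(volume.restrict (ball c (2 * ρ₀))), _ := ae_restrict_of_ae_restrict_of_subset hball2_cell hcovG
    filter_upwards [h1, hGf] with y hy1 hy2
    rw [← hy2, hy1, cellShift_apply]
  -- translate back: the representative is `g (· − a e_z)`
  have hpre : (fun x : ℝ³ => x - a • eZ) ⁻¹' ball c (2 * ρ₀) = ball x₀ (2 * ρ₀) := by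
    ext x
    simp only [mem_preimage, mem_ball, hc, dist_eq_norm, sub_sub_sub_cancel_right]
  refine ⟨ρ₀, hρ₀pos, fun x => g (x - a • eZ), ?_, ?_, ?_⟩
  · exact (hgs.comp (contDiff_id.sub contDiff_const)).contDiffOn
  · have h := ae_restrict_comp_sub_of_ae_restrict hBm (a • eZ) hq_ball
    rw [hpre] at h
    filter_upwards [h] with x hx
    rwa [sub_add_cancel] at hx
  · have h := ae_restrict_comp_sub_of_ae_restrict hBm (a • eZ) hG_ball
    rw [hpre] at h
    filter_upwards [h] with x hx
    rw [sub_add_cancel] at hx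
    rw [hx, gradient, gradient]
    congr 1
    rw [show (fun x => g (x - a • eZ)) = fun x => g (x + -(a • eZ)) by funext; rw [sub_eq_add_neg], fderiv_comp_add_right,
      ← sub_eq_add_neg]

/-! ### The smooth periodic representative on the interior tube -/

/-- **A smooth `L`-periodic representative of the potential on the open tube `{r < 0.7} × ℝ`**:
for the weak Neumann solution `∇q[h₀,h₁]` with smooth periodic data (`∫_cell h₀ = 0`) there is
`qI : ℝ³ → ℝ`, `C^∞` on the tube, `L`-periodic, with `q ∘ axialRed = qI` and
`∇q ∘ axialRed = ∇qI` a.e. on the tube (patch the local representatives,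
`exists_periodic_smooth_rep_of_local`). [folklore] -/
theorem exists_tube_smooth_rep (hL : 0 < L) {h₀ : ℝ³ → ℝ} {h₁ : ℝ³ → ℝ³} (hh₀ : IsSmoothPeriodic L h₀)
    (hh₁ : IsSmoothPeriodic L h₁) (hmean : ∫ x in (cylinderCell L : Set ℝ³), h₀ x = 0) :
    ∃ qI : ℝ³ → ℝ, ContDiffOn ℝ ∞ qI {x : ℝ³ | cylRadius x < 0.7} ∧ IsAxiallyPeriodic L qI ∧
      (∀ᵐ x ∂(volume.restrict {x : ℝ³ | cylRadius x < 0.7}),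
        ((potential (neumannGrad L (toCell L h₀) (toCell L h₁)) : Lp ℝ 2 (cellMeasure L)) : ℝ³ → ℝ) (axialRed L x) = qI x) ∧
      (∀ᵐ x ∂(volume.restrict {x : ℝ³ | cylRadius x < 0.7}),
        ((((neumannGrad L (toCell L h₀) (toCell L h₁) : gradSpace L) : Lp ℝ³ 2 (cellMeasure L)) : ℝ³ → ℝ³))
          (axialRed L x) = gradient qI x) := by
  have hUo : IsOpen {x : ℝ³ | cylRadius x < 0.7} := isOpen_lt continuous_cylRadius continuous_const
  have hUper : ∀ x : ℝ³, x + L • eZ ∈ {x : ℝ³ | cylRadius x < 0.7} ↔ x ∈ {x : ℝ³ | cylRadius x < 0.7} :=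
    fun x => by simp only [mem_setOf_eq, cylRadius_add_smul_eZ]
  have hQp : IsAxiallyPeriodic L fun x =>
      ((potential (neumannGrad L (toCell L h₀) (toCell L h₁)) : Lp ℝ 2 (cellMeasure L)) : ℝ³ → ℝ) (axialRed L x) :=
    fun x => by
      change _ = ((potential (neumannGrad L (toCell L h₀) (toCell L h₁)) : Lp ℝ 2 (cellMeasure L)) : ℝ³ → ℝ) (axialRed L x)
      rw [← axialRed_add_period hL x]
      rfl
  exact exists_periodic_smooth_rep_of_local hL hUo hUper hQp fun x hx =>
    exists_local_smooth_rep_interior hL hh₀ hh₁ hmean hx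

end PeriodicCylinder

end Literature.Analysis.FluidPDE
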